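import Summits.QuantumFields.YangMills.Theorems.PoincareLipschitzTwoSidedOfConcentrationBudget
import Literature.MathematicalPhysics.QuantumFieldTheory.Balaban1983to89.T3UnitScaleTilt
import HarnessLib

/-!
# LINE 27 «MedianCentring» — support workfile: the LOCAL-GOOD BUDGET AT PRECISION `θ(K−j)/M` (critic #320, price P4: «γ_B scalar lemma first»)

✓`localGood_budget` (PoincareLipschitzTwoSidedOfConcentrationBudget) bounds the union-bound mass of the complement of the local good event
`G(a,j)` by `1/4` for `γ ≤ γ_A`.  Stub (M) `stub_meanOfMedian` of `Cruxes/HistoryTailL/Lines/median_centring.lean` re-runs that budget at precision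
`θ(K−j)/16` (and needs the level-`j` window tail `C·e^{−c p(g_(K−j))²} ≤ θ(K−j)/16` as well).  THIS FILE proves both scalar facts, for an arbitrary
divisor `M ≥ 1`, sorry-free:

* `localGood_budget_theta` — the SAME left-hand side as ✓`localGood_budget`, bounded by `θBal L γ b₀ p₀ (K − j) / M` for `0 < γ ≤ γ_B(L,b₀,p₀,V,C₀,c₀,Cc,c₁,M)`;
* `windowTail_le_theta` — `C·exp(−c·p(g_(K−j))²) ≤ θBal L γ b₀ p₀ (K − j) / M` for `0 < γ ≤ γ_T`.

Mechanism (as in the landed file, one power sharper): with `x_h = log g_h⁻¹ ≥ X' = 20/(b₀² min(c₀,c₁)) + 1` every term is `≤ const·e^{16x_h − c x_h²}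
≤ const·e^{−4x_h} = const·(γL^{−h})²`, and for the heights `h ∈ {K} ∪ {K−i : 1 ≤ i < j}` (all `≥ K−j`) `(γL^{−h})² ≤ γL^{−h}·g_(K−j)²`; summing,
`total ≤ V(C₀+Cc)·γ·g_(K−j)² ≤ (b₀/M)·g_(K−j) ≤ θ(K−j)/M` because `p(g) ≥ b₀` and `γ ≤ b₀/(M·(V(C₀+Cc)+1))`.
Elementary real analysis; no stub of the skeleton, no crux, rung (R3 = YM₃ on T³; NOT d = 4, NOT Clay) or summit is proved; YM is NOT proved.
-/

set_option autoImplicit false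

namespace Summit.QuantumFields.YangMills.Cruxes.HistoryTailL.MedianCentring

open scoped BigOperators
open Literature.MathematicalPhysics.QuantumFieldTheory.Balaban1983to89
open Literature.MathematicalPhysics.QuantumFieldTheory.Balaban1983to89.T3UnitScaleTilt (θBal)
open Summit.QuantumFields.YangMills.Theorems.PoincareLipschitz.TwoSidedOfConcentration

/-- `b₀·g ≤ θBal = g·p(g)` since `p(g) = b₀(1 + log g⁻¹)^{p₀} ≥ b₀` on `(0,1]` for `p₀ ≥ 0`. [cite: Balaban1985UV3, (7) p.257] -/
theorem coupling_mul_b₀_le_θBal {L : ℕ} (hL : 1 ≤ L) {γ b₀ p₀ : ℝ} (hγ : 0 < γ) (hγ1 : γ ≤ 1) (hb₀ : 0 ≤ b₀) (hp₀ : 0 ≤ p₀) (h : ℕ) :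
    b₀ * Real.sqrt (γ * ((L : ℝ)⁻¹) ^ h) ≤ θBal L γ b₀ p₀ h := by
  obtain ⟨hg, hg1, _, _⟩ := coupling_basic hL hγ hγ1 h
  set g := Real.sqrt (γ * ((L : ℝ)⁻¹) ^ h) with hgdef
  have hx : 0 ≤ Real.log g⁻¹ := B10.log_inv_nonneg_of_le_one hg hg1
  have h1 : (1 : ℝ) ≤ (1 + Real.log g⁻¹) ^ p₀ := Real.one_le_rpow (by linarith) hp₀
  have hp : b₀ ≤ B10.pFun b₀ p₀ g := by
    unfold B10.pFun
    calc b₀ = b₀ * 1 := (mul_one _).symm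
      _ ≤ b₀ * (1 + Real.log g⁻¹) ^ p₀ := mul_le_mul_of_nonneg_left h1 hb₀
  unfold θBal
  rw [← hgdef, mul_comm]
  exact mul_le_mul_of_nonneg_left hp hg.le

/-- The sharper pointwise estimate: for `γ ≤ e^{−2X'}`, `X' = 20/c + 1`, every `A ≤ 16`:
`e^{A x_h}·e^{−c x_h²} ≤ (γL^{−h})²` (`x_h = log g_h⁻¹`, `(γL^{−h})⁻¹ = e^{2x_h}`). [folklore] -/
theorem key_fourth {L : ℕ} (hL : 1 ≤ L) {γ c : ℝ} (hγ : 0 < γ) (hγ1 : γ ≤ 1) (hc : 0 < c)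
    (hγX : γ ≤ Real.exp (-(2 * (20 / c + 1)))) (h : ℕ) (A : ℝ) (hA : A ≤ 16) :
    Real.exp (A * Real.log (Real.sqrt (γ * ((L : ℝ)⁻¹) ^ h))⁻¹) *
        Real.exp (-(c * Real.log (Real.sqrt (γ * ((L : ℝ)⁻¹) ^ h))⁻¹ ^ 2)) ≤ (γ * ((L : ℝ)⁻¹) ^ h) ^ 2 := by
  obtain ⟨hg, hg1, hg2, _⟩ := coupling_basic hL hγ hγ1 h
  have hx := log_inv_coupling_ge hL hγ hγ1 hγX h
  set x := Real.log (Real.sqrt (γ * ((L : ℝ)⁻¹) ^ h))⁻¹ with hxdef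
  have hX0 : (0 : ℝ) ≤ 20 / c + 1 := by positivity
  have hx0 : 0 ≤ x := hX0.trans hx
  -- `c x² ≥ 20 x` since `x ≥ 20/c + 1`
  have hquad : 20 * x ≤ c * x ^ 2 := by
    have h1 : 20 ≤ c * (20 / c + 1) := by
      rw [mul_add, mul_div_cancel₀ _ hc.ne']
      linarith [hc]
    have h2 : c * (20 / c + 1) ≤ c * x := mul_le_mul_of_nonneg_left hx hc.le
    nlinarith
  -- `(γL^{-h})² = e^{-4x}`
  have hsq : (γ * ((L : ℝ)⁻¹) ^ h) ^ 2 = Real.exp (-(4 * x)) := by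
    have hinv : (γ * ((L : ℝ)⁻¹) ^ h)⁻¹ = Real.exp (2 * x) := inv_coupling_sq_eq_exp hL hγ hγ1 h
    have hpos : 0 < γ * ((L : ℝ)⁻¹) ^ h := by rw [← hg2]; exact pow_pos hg 2
    have : γ * ((L : ℝ)⁻¹) ^ h = Real.exp (-(2 * x)) := by
      rw [Real.exp_neg, ← hinv, inv_inv]
    rw [this, ← Real.exp_nat_mul]
    ring_nf
  rw [hsq, ← Real.exp_add]
  exact Real.exp_le_exp.mpr (by nlinarith)

/-- **THE LOCAL-GOOD BUDGET AT PRECISION `θ(K−j)/M` (critic #320 P4, the `γ_B` scalar lemma).**  Same left-hand side as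
✓`localGood_budget`; for `L ≥ 2`, `b₀ > 0`, `p₀ ≥ 1`, `V, C₀, Cc ≥ 0`, `c₀, c₁ > 0`, `M ≥ 1` there is `γ_B ∈ (0,1]` with
`total ≤ θBal L γ b₀ p₀ (K − j) / M` for all `0 < γ ≤ γ_B`, all `K`, all `j ≤ K`. [folklore; adapted from ✓`localGood_budget`] -/
theorem localGood_budget_theta {L : ℕ} (hL : 2 ≤ L) {b₀ p₀ V C₀ c₀ Cc c₁ M : ℝ} (hb₀ : 0 < b₀) (hp₀ : 1 ≤ p₀) (hV : 0 ≤ V)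
    (hC₀ : 0 ≤ C₀) (hc₀ : 0 < c₀) (hCc : 0 ≤ Cc) (hc₁ : 0 < c₁) (hM : 1 ≤ M) :
    ∃ γB : ℝ, 0 < γB ∧ γB ≤ 1 ∧ ∀ γ : ℝ, 0 < γ → γ ≤ γB → ∀ K j : ℕ, j ≤ K →
      V * ((L : ℝ) ^ j) ^ 3 * (C₀ * ((γ * ((L : ℝ)⁻¹) ^ K)⁻¹) ^ 5 *
          Real.exp (-(c₀ * B10.pFun b₀ p₀ (Real.sqrt (γ * ((L : ℝ)⁻¹) ^ K)) ^ 2))) +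
        ∑ i ∈ Finset.Ico 1 j, V * ((L : ℝ) ^ (j - i)) ^ 3 *
          (Cc * Real.exp (-(c₁ * B10.pFun b₀ p₀ (Real.sqrt (γ * ((L : ℝ)⁻¹) ^ (K - i))) ^ 2))) ≤
        θBal L γ b₀ p₀ (K - j) / M := by
  have hL1 : 1 ≤ L := by omega
  have hL' : (1 : ℝ) ≤ L := by exact_mod_cast hL1
  have hM0 : 0 < M := by linarith
  -- the quadratic rate
  set c : ℝ := min c₀ c₁ * b₀ ^ 2 with hc
  have hcpos : 0 < c := mul_pos (lt_min hc₀ hc₁) (pow_pos hb₀ 2)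
  set X : ℝ := 20 / c + 1 with hX
  have hX0 : 0 ≤ X := by positivity
  -- the threshold
  set D : ℝ := V * (C₀ + Cc) + 1 with hD
  have hD0 : 0 < D := by positivity
  refine ⟨min 1 (min (Real.exp (-(2 * X))) (b₀ / (M * D))), by positivity,
    min_le_left _ _, fun γ hγ hγA K j hjK => ?_⟩
  have hγ1 : γ ≤ 1 := hγA.trans (min_le_left _ _)
  have hγX : γ ≤ Real.exp (-(2 * X)) := hγA.trans ((min_le_right _ _).trans (min_le_left _ _))
  have hγD : γ ≤ b₀ / (M * D) := hγA.trans ((min_le_right _ _).trans (min_le_right _ _))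
  -- abbreviation: the running coupling squared at height `K - j`
  set G2 : ℝ := γ * ((L : ℝ)⁻¹) ^ (K - j) with hG2
  obtain ⟨hgKj, hgKj1, hgKj2, hG2γ⟩ := coupling_basic hL1 hγ hγ1 (K - j)
  have hG2pos : 0 < G2 := by rw [hG2, ← hgKj2]; exact pow_pos hgKj 2
  -- heights `h ≥ K - j` have `(γL^{-h})² ≤ γL^{-h} · G2`
  have hsqle : ∀ h : ℕ, K - j ≤ h → (γ * ((L : ℝ)⁻¹) ^ h) ^ 2 ≤ γ * ((L : ℝ)⁻¹) ^ h * G2 := by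
    intro h hh
    have hr0 : 0 ≤ (L : ℝ)⁻¹ := inv_nonneg.mpr (by linarith)
    have hr1 : (L : ℝ)⁻¹ ≤ 1 := inv_le_one_of_one_le₀ hL'
    have hmono : ((L : ℝ)⁻¹) ^ h ≤ ((L : ℝ)⁻¹) ^ (K - j) := pow_le_pow_of_le_one hr0 hr1 hh
    have hnn : 0 ≤ γ * ((L : ℝ)⁻¹) ^ h := mul_nonneg hγ.le (pow_nonneg hr0 h)
    rw [sq, hG2]
    exact mul_le_mul_of_nonneg_left (mul_le_mul_of_nonneg_left hmono hγ.le) hnn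
  -- `p(g_h)² ≥ b₀² x_h²`, hence `e^{-cᵢ p²} ≤ e^{-c x²}`
  have hrate : ∀ h : ℕ, ∀ c' : ℝ, min c₀ c₁ ≤ c' →
      Real.exp (-(c' * B10.pFun b₀ p₀ (Real.sqrt (γ * ((L : ℝ)⁻¹) ^ h)) ^ 2)) ≤
        Real.exp (-(c * Real.log (Real.sqrt (γ * ((L : ℝ)⁻¹) ^ h))⁻¹ ^ 2)) := by
    intro h c' hc'
    obtain ⟨hg, hg1, _, _⟩ := coupling_basic hL1 hγ hγ1 h
    have hp := sq_log_le_pFun_sq (b₀ := b₀) hp₀ hg hg1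
    have hmin0 : 0 ≤ min c₀ c₁ := (lt_min hc₀ hc₁).le
    refine Real.exp_le_exp.mpr (neg_le_neg ?_)
    calc c * Real.log (Real.sqrt (γ * ((L : ℝ)⁻¹) ^ h))⁻¹ ^ 2
        = min c₀ c₁ * (b₀ ^ 2 * Real.log (Real.sqrt (γ * ((L : ℝ)⁻¹) ^ h))⁻¹ ^ 2) := by rw [hc]; ring
      _ ≤ min c₀ c₁ * B10.pFun b₀ p₀ (Real.sqrt (γ * ((L : ℝ)⁻¹) ^ h)) ^ 2 := mul_le_mul_of_nonneg_left hp hmin0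
      _ ≤ c' * B10.pFun b₀ p₀ (Real.sqrt (γ * ((L : ℝ)⁻¹) ^ h)) ^ 2 := mul_le_mul_of_nonneg_right hc' (sq_nonneg _)
  -- level-0 term `≤ V C₀ γ G2`
  have hT0 : V * ((L : ℝ) ^ j) ^ 3 * (C₀ * ((γ * ((L : ℝ)⁻¹) ^ K)⁻¹) ^ 5 *
      Real.exp (-(c₀ * B10.pFun b₀ p₀ (Real.sqrt (γ * ((L : ℝ)⁻¹) ^ K)) ^ 2))) ≤ V * C₀ * (γ * G2) := by
    set x := Real.log (Real.sqrt (γ * ((L : ℝ)⁻¹) ^ K))⁻¹ with hxdef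
    have hLj : ((L : ℝ) ^ j) ^ 3 ≤ ((L : ℝ) ^ K) ^ 3 :=
      pow_le_pow_left₀ (by positivity) (pow_le_pow_right₀ hL' hjK) 3
    have hLK : ((L : ℝ) ^ K) ^ 3 ≤ Real.exp (6 * x) := pow_cube_le_exp hL1 hγ hγ1 K
    have hβ : ((γ * ((L : ℝ)⁻¹) ^ K)⁻¹) ^ 5 = Real.exp (10 * x) := by
      rw [inv_coupling_sq_eq_exp hL1 hγ hγ1 K, ← hxdef, ← Real.exp_nat_mul]; ring_nf
    have hE := hrate K c₀ (min_le_left _ _)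
    have hk := key_fourth hL1 hγ hγ1 hcpos hγX K 16 le_rfl
    have hL3 : ((L : ℝ) ^ j) ^ 3 ≤ Real.exp (6 * x) := hLj.trans hLK
    have hK2 := hsqle K (Nat.sub_le K j)
    calc V * ((L : ℝ) ^ j) ^ 3 * (C₀ * ((γ * ((L : ℝ)⁻¹) ^ K)⁻¹) ^ 5 *
          Real.exp (-(c₀ * B10.pFun b₀ p₀ (Real.sqrt (γ * ((L : ℝ)⁻¹) ^ K)) ^ 2)))
        ≤ V * Real.exp (6 * x) * (C₀ * Real.exp (10 * x) * Real.exp (-(c * x ^ 2))) := by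
          rw [hβ]
          gcongr
      _ = V * C₀ * (Real.exp (16 * x) * Real.exp (-(c * x ^ 2))) := by
          have : Real.exp (16 * x) = Real.exp (6 * x) * Real.exp (10 * x) := by rw [← Real.exp_add]; ring_nf
          rw [this]; ring
      _ ≤ V * C₀ * (γ * ((L : ℝ)⁻¹) ^ K) ^ 2 := by gcongr
      _ ≤ V * C₀ * (γ * ((L : ℝ)⁻¹) ^ K * G2) := by gcongr
      _ ≤ V * C₀ * (γ * G2) := by
          have hlast : γ * ((L : ℝ)⁻¹) ^ K * G2 ≤ γ * G2 :=
            mul_le_mul_of_nonneg_right (coupling_basic hL1 hγ hγ1 K).2.2.2 hG2pos.le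
          gcongr
  -- level-`i` terms `≤ V Cc γ L^{-(K-i)} G2`
  have hTi : ∀ i ∈ Finset.Ico 1 j, V * ((L : ℝ) ^ (j - i)) ^ 3 *
      (Cc * Real.exp (-(c₁ * B10.pFun b₀ p₀ (Real.sqrt (γ * ((L : ℝ)⁻¹) ^ (K - i))) ^ 2))) ≤
        V * Cc * (γ * ((L : ℝ)⁻¹) ^ (K - i) * G2) := by
    intro i hi
    rw [Finset.mem_Ico] at hi
    set x := Real.log (Real.sqrt (γ * ((L : ℝ)⁻¹) ^ (K - i)))⁻¹ with hxdef
    have hLj : ((L : ℝ) ^ (j - i)) ^ 3 ≤ ((L : ℝ) ^ (K - i)) ^ 3 :=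
      pow_le_pow_left₀ (by positivity) (pow_le_pow_right₀ hL' (by omega)) 3
    have hLK : ((L : ℝ) ^ (K - i)) ^ 3 ≤ Real.exp (6 * x) := pow_cube_le_exp hL1 hγ hγ1 (K - i)
    have hE := hrate (K - i) c₁ (min_le_right _ _)
    have hk := key_fourth hL1 hγ hγ1 hcpos hγX (K - i) 6 (by norm_num)
    have hL3 : ((L : ℝ) ^ (j - i)) ^ 3 ≤ Real.exp (6 * x) := hLj.trans hLK
    have hi2 := hsqle (K - i) (by omega)
    calc V * ((L : ℝ) ^ (j - i)) ^ 3 * (Cc * Real.exp (-(c₁ * B10.pFun b₀ p₀ (Real.sqrt (γ * ((L : ℝ)⁻¹) ^ (K - i))) ^ 2)))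
        ≤ V * Real.exp (6 * x) * (Cc * Real.exp (-(c * x ^ 2))) := by
          gcongr
      _ = V * Cc * (Real.exp (6 * x) * Real.exp (-(c * x ^ 2))) := by ring
      _ ≤ V * Cc * (γ * ((L : ℝ)⁻¹) ^ (K - i)) ^ 2 := by gcongr
      _ ≤ V * Cc * (γ * ((L : ℝ)⁻¹) ^ (K - i) * G2) := by gcongr
  -- sum up
  have hsum : ∑ i ∈ Finset.Ico 1 j, V * ((L : ℝ) ^ (j - i)) ^ 3 *
      (Cc * Real.exp (-(c₁ * B10.pFun b₀ p₀ (Real.sqrt (γ * ((L : ℝ)⁻¹) ^ (K - i))) ^ 2))) ≤ V * Cc * (γ * G2) := by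
    calc ∑ i ∈ Finset.Ico 1 j, V * ((L : ℝ) ^ (j - i)) ^ 3 *
          (Cc * Real.exp (-(c₁ * B10.pFun b₀ p₀ (Real.sqrt (γ * ((L : ℝ)⁻¹) ^ (K - i))) ^ 2)))
        ≤ ∑ i ∈ Finset.Ico 1 j, V * Cc * (γ * ((L : ℝ)⁻¹) ^ (K - i) * G2) := Finset.sum_le_sum hTi
      _ = V * Cc * (γ * G2) * ∑ i ∈ Finset.Ico 1 j, ((L : ℝ)⁻¹) ^ (K - i) := by rw [Finset.mul_sum]; ring_nf
      _ ≤ V * Cc * (γ * G2) * 1 := by gcongr; exact sum_Ico_inv_pow_le_one hL hjK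
      _ = V * Cc * (γ * G2) := mul_one _
  -- `V (C₀ + Cc) γ G2 ≤ (b₀/M) · g_(K-j) ≤ θ/M`
  have hθ : b₀ * Real.sqrt G2 ≤ θBal L γ b₀ p₀ (K - j) :=
    coupling_mul_b₀_le_θBal hL1 hγ hγ1 hb₀.le (by linarith) (K - j)
  have hG2le : G2 ≤ Real.sqrt G2 := by
    -- `G2 = g²` with `g ≤ 1`
    rw [hG2, ← hgKj2]
    rw [Real.sqrt_sq hgKj.le]
    calc Real.sqrt (γ * ((L : ℝ)⁻¹) ^ (K - j)) ^ 2
        = Real.sqrt (γ * ((L : ℝ)⁻¹) ^ (K - j)) * Real.sqrt (γ * ((L : ℝ)⁻¹) ^ (K - j)) := sq _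
      _ ≤ Real.sqrt (γ * ((L : ℝ)⁻¹) ^ (K - j)) * 1 := mul_le_mul_of_nonneg_left hgKj1 hgKj.le
      _ = Real.sqrt (γ * ((L : ℝ)⁻¹) ^ (K - j)) := mul_one _
  have hfin : V * C₀ * (γ * G2) + V * Cc * (γ * G2) ≤ θBal L γ b₀ p₀ (K - j) / M := by
    have h1 : V * C₀ * (γ * G2) + V * Cc * (γ * G2) = V * (C₀ + Cc) * γ * G2 := by ring
    rw [h1]
    have h2 : V * (C₀ + Cc) ≤ D := by rw [hD]; linarith
    have h3 : V * (C₀ + Cc) * γ * G2 ≤ D * γ * G2 := by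
      have := mul_le_mul_of_nonneg_right h2 hγ.le
      exact mul_le_mul_of_nonneg_right this hG2pos.le
    have h4 : D * γ ≤ b₀ / M := by
      have := mul_le_mul_of_nonneg_left hγD hD0.le
      have h5 : D * (b₀ / (M * D)) = b₀ / M := by field_simp
      linarith
    have h6 : D * γ * G2 ≤ b₀ / M * Real.sqrt G2 := by
      calc D * γ * G2 ≤ b₀ / M * G2 := mul_le_mul_of_nonneg_right h4 hG2pos.le
        _ ≤ b₀ / M * Real.sqrt G2 := mul_le_mul_of_nonneg_left hG2le (by positivity)
    have h7 : b₀ / M * Real.sqrt G2 = (b₀ * Real.sqrt G2) / M := by ring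
    have h8 : (b₀ * Real.sqrt G2) / M ≤ θBal L γ b₀ p₀ (K - j) / M := div_le_div_of_nonneg_right hθ hM0.le
    linarith
  linarith [hT0, hsum]

/-- **THE LEVEL-`j` WINDOW TAIL AT PRECISION `θ(K−j)/M`.**  For `L ≥ 2`, `b₀ > 0`, `p₀ ≥ 1`, `C ≥ 0`, `c > 0`, `M ≥ 1` there is `γ_T ∈ (0,1]` with
`C·exp(−c·p(g_(K−j))²) ≤ θBal L γ b₀ p₀ (K − j) / M` for all `0 < γ ≤ γ_T`, all `K`, `j ≤ K` (the term `2C·e^{−cp²}` of stub (M)). [folklore] -/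
theorem windowTail_le_theta {L : ℕ} (hL : 2 ≤ L) {b₀ p₀ C c M : ℝ} (hb₀ : 0 < b₀) (hp₀ : 1 ≤ p₀) (hC : 0 ≤ C) (hc : 0 < c)
    (hM : 1 ≤ M) :
    ∃ γT : ℝ, 0 < γT ∧ γT ≤ 1 ∧ ∀ γ : ℝ, 0 < γ → γ ≤ γT → ∀ K j : ℕ, j ≤ K →
      C * Real.exp (-(c * B10.pFun b₀ p₀ (Real.sqrt (γ * ((L : ℝ)⁻¹) ^ (K - j))) ^ 2)) ≤ θBal L γ b₀ p₀ (K - j) / M := by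
  -- the budget theorem with `V := 1`, `C₀ := 0`, `Cc := C`, `c₀ := c₁ := c` at `j + 1 ≤ K + 1`… is not literally this term (heights differ),
  -- so we run the pointwise chain directly.
  have hL1 : 1 ≤ L := by omega
  have hL' : (1 : ℝ) ≤ L := by exact_mod_cast hL1
  have hM0 : 0 < M := by linarith
  set c' : ℝ := c * b₀ ^ 2 with hc'
  have hcpos : 0 < c' := mul_pos hc (pow_pos hb₀ 2)
  set X : ℝ := 20 / c' + 1 with hX
  set D : ℝ := C + 1 with hD
  have hD0 : 0 < D := by positivity
  refine ⟨min 1 (min (Real.exp (-(2 * X))) (b₀ / (M * D))), by positivity,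
    min_le_left _ _, fun γ hγ hγA K j hjK => ?_⟩
  have hγ1 : γ ≤ 1 := hγA.trans (min_le_left _ _)
  have hγX : γ ≤ Real.exp (-(2 * X)) := hγA.trans ((min_le_right _ _).trans (min_le_left _ _))
  have hγD : γ ≤ b₀ / (M * D) := hγA.trans ((min_le_right _ _).trans (min_le_right _ _))
  set G2 : ℝ := γ * ((L : ℝ)⁻¹) ^ (K - j) with hG2
  obtain ⟨hg, hg1, hg2, hG2γ⟩ := coupling_basic hL1 hγ hγ1 (K - j)
  have hG2pos : 0 < G2 := by rw [hG2, ← hg2]; exact pow_pos hg 2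
  set x := Real.log (Real.sqrt (γ * ((L : ℝ)⁻¹) ^ (K - j)))⁻¹ with hxdef
  have hp := sq_log_le_pFun_sq (b₀ := b₀) hp₀ hg hg1
  have hE : Real.exp (-(c * B10.pFun b₀ p₀ (Real.sqrt (γ * ((L : ℝ)⁻¹) ^ (K - j))) ^ 2)) ≤ Real.exp (-(c' * x ^ 2)) := by
    refine Real.exp_le_exp.mpr (neg_le_neg ?_)
    calc c' * x ^ 2 = c * (b₀ ^ 2 * x ^ 2) := by rw [hc']; ring
      _ ≤ c * B10.pFun b₀ p₀ (Real.sqrt (γ * ((L : ℝ)⁻¹) ^ (K - j))) ^ 2 := mul_le_mul_of_nonneg_left hp hc.le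
  have hk := key_fourth hL1 hγ hγ1 hcpos hγX (K - j) 0 (by norm_num)
  rw [zero_mul, Real.exp_zero, one_mul] at hk
  -- `e^{-c p²} ≤ G2² ≤ γ G2`
  have h1 : C * Real.exp (-(c * B10.pFun b₀ p₀ (Real.sqrt (γ * ((L : ℝ)⁻¹) ^ (K - j))) ^ 2)) ≤ C * (γ * G2) := by
    calc C * Real.exp (-(c * B10.pFun b₀ p₀ (Real.sqrt (γ * ((L : ℝ)⁻¹) ^ (K - j))) ^ 2))
        ≤ C * Real.exp (-(c' * x ^ 2)) := mul_le_mul_of_nonneg_left hE hC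
      _ ≤ C * G2 ^ 2 := mul_le_mul_of_nonneg_left hk hC
      _ = C * (G2 * G2) := by rw [sq]
      _ ≤ C * (γ * G2) := mul_le_mul_of_nonneg_left (mul_le_mul_of_nonneg_right hG2γ hG2pos.le) hC
  have hθ : b₀ * Real.sqrt G2 ≤ θBal L γ b₀ p₀ (K - j) :=
    coupling_mul_b₀_le_θBal hL1 hγ hγ1 hb₀.le (by linarith) (K - j)
  have hG2le : G2 ≤ Real.sqrt G2 := by
    rw [hG2, ← hg2, Real.sqrt_sq hg.le]
    calc Real.sqrt (γ * ((L : ℝ)⁻¹) ^ (K - j)) ^ 2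
        = Real.sqrt (γ * ((L : ℝ)⁻¹) ^ (K - j)) * Real.sqrt (γ * ((L : ℝ)⁻¹) ^ (K - j)) := sq _
      _ ≤ Real.sqrt (γ * ((L : ℝ)⁻¹) ^ (K - j)) * 1 := mul_le_mul_of_nonneg_left hg1 hg.le
      _ = Real.sqrt (γ * ((L : ℝ)⁻¹) ^ (K - j)) := mul_one _
  have h2 : C * (γ * G2) ≤ θBal L γ b₀ p₀ (K - j) / M := by
    have h3 : C ≤ D := by rw [hD]; linarith
    have h4 : C * (γ * G2) ≤ D * γ * G2 := by
      have := mul_le_mul_of_nonneg_right h3 (mul_nonneg hγ.le hG2pos.le)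
      linarith [this]
    have h5 : D * γ ≤ b₀ / M := by
      have := mul_le_mul_of_nonneg_left hγD hD0.le
      have h6 : D * (b₀ / (M * D)) = b₀ / M := by field_simp
      linarith
    have h7 : D * γ * G2 ≤ b₀ / M * Real.sqrt G2 := by
      calc D * γ * G2 ≤ b₀ / M * G2 := mul_le_mul_of_nonneg_right h5 hG2pos.le
        _ ≤ b₀ / M * Real.sqrt G2 := mul_le_mul_of_nonneg_left hG2le (by positivity)
    have h8 : b₀ / M * Real.sqrt G2 = (b₀ * Real.sqrt G2) / M := by ring
    have h9 : (b₀ * Real.sqrt G2) / M ≤ θBal L γ b₀ p₀ (K - j) / M := div_le_div_of_nonneg_right hθ hM0.le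
    linarith
  exact h1.trans h2

end Summit.QuantumFields.YangMills.Cruxes.HistoryTailL.MedianCentring
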